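import Literature.Barriers.HodgeConjecture.KaehlerCoherentSheaves
import HarnessLib

/-!
# Voisin's Weil torus (barrier `KaehlerCoherentSheaves`): proofs file — what the fact carries

Companion (proofs only, no new definitions or named facts) of
`Literature/Barriers/HodgeConjecture/KaehlerCoherentSheaves.lean`, which vendors Voisin's
counterexample to the Kähler Hodge conjecture as the named fact
`Voisin2002_weilTorus_hodgeClassWithoutSubvarieties = Nonempty (VoisinWeilTorusWitness (Fin 4 → ℂ))`
(C. Voisin, IMRN 2002 no. 20, Thm. 1, §2 (a)–(b), §3 Prop. 3). This file is the home of the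
discharge programme for that fact; at present it records the first, purely formal, step:

* `VoisinWeilTorusWitness.exists_complexDeRhamIsoFamily`: a witness charted on `E` CARRIES de
  Rham's theorem with complex coefficients over `E` — its type-`(2,2)` clause is stated with the
  `∃`-convention of `IsOfTypeOnManifold` (`∃ e : ComplexDeRhamIsoFamily E, e.IsNatural ∧ …`), so it
  packages a natural comparison family `H^•_dR(–; ℂ) ≃ H^•(–; ℂ)` over ALL real-`C^∞`, Hausdorff,
  σ-compact manifolds charted on `E`, i.e. a witness of the tree's named fact
  `Literature.NumberTheory.Transcendental.exists_complexDeRhamIsoFamily E` (de Rham 1931 `⊗ ℂ`;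
  Wells (1980), Thm. III.4.13);
* `Voisin2002_weilTorus_hodgeClassWithoutSubvarieties.exists_complexDeRhamIsoFamily`: hence the
  barrier fact implies `exists_complexDeRhamIsoFamily (Fin 4 → ℂ)`, an UNDISCHARGED named fact of
  the tree — the precise upstream prerequisite of any `…_holds`.

## The discharge programme (status 2026-08-15)

With `X = ComplexTorus Φ` (`Literature/Geometry/Kaehler/ComplexTorus*.lean`) for the EXPLICIT
period isomorphism `Φ = Weil.periodEquiv : ℝ⁸ ≃ ℂ⁴` of Weil type
(`Literature/Geometry/Kaehler/ComplexTorusWeilPeriod.lean`: transcendental period `t`, `ℤ[I]`-stable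
lattice with `I` acting as `J = diag(i, i, -i, -i)`), the fact is now ASSEMBLED from two leaves in
`Literature/Barriers/HodgeConjecture/KaehlerCoherentSheavesAssemblyProofs.lean`
(`Voisin2002_weilTorus_hodgeClassWithoutSubvarieties_of_leaves`):

1. de Rham's theorem over `ℂ⁴`, the named fact `exists_complexDeRhamIsoFamily (Fin 4 → ℂ)` (which
   the fact implies back, above);
2. Voisin's §2 (b) for `X`: every closed analytic subset `Z ≠ X` is finite (simplicity + `NS = 0`
   + the structure of subvarieties of complex tori; not in the tree).

Everything else is PROVED: clause (c), a non-zero rational class of type `(2,2)` in `H⁴(X; ℂ)`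
(`KaehlerCoherentSheavesWeilClassProofs.lean`: `(1 + I)^*` has `T⁴ = 256` and `ker(T + 4) ⊆ H^{2,2}`
by `Literature/Geometry/Kaehler/ComplexTorusWeilJ.lean`, `ComplexTorusWeilEigen.lean`; rational
classes span `H⁴(X; ℂ)`), and clause (a), `NS(X) = 0`
(`KaehlerCoherentSheavesAssemblyProofs.lean`: rational classes of a torus are proportional to
rational invariant forms, `KaehlerCoherentSheavesRationalFormsProofs.lean` — naturality of the
comparison family under the integer matrices and universal coefficients, no Künneth formula — and
no non-zero rational invariant form of type `(1,1)` exists on the explicit torus,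
`Literature/Geometry/Kaehler/ComplexTorusWeilNeronSeveri.lean`, by transcendence of `t`).

## References

* [Voisin2002KaehlerCounterexample] C. Voisin, IMRN 2002 no. 20, 1057–1075 (arXiv
  math/0112247): Thm. 1; §2 (a)–(c), Prop. 1; §3 Prop. 3.
* [WellsDACM1980] R. O. Wells, *Differential Analysis on Complex Manifolds* (1980),
  Thm. III.4.13 (de Rham's theorem, complex coefficients).
-/

noncomputable section

open scoped Manifold ContDiff Topology

universe u

namespace Literature.Barriers.HodgeConjecture

section Barriers
section HodgeConjecture

open Literature.AlgebraicGeometry.HodgeTheory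

/-- **A Voisin witness charted on `E` carries de Rham's theorem (complex coefficients) over `E`.**
The field `isOfType` is stated with the `∃`-convention of `IsOfTypeOnManifold`: it provides a
NATURAL complex de Rham comparison family `H^•_dR(–; ℂ) ≃ H^•(–; ℂ)` over ALL real-`C^∞`,
Hausdorff, σ-compact manifolds charted on `E`, i.e. exactly a witness of the tree's named fact
`Literature.NumberTheory.Transcendental.exists_complexDeRhamIsoFamily E` (de Rham 1931 `⊗ ℂ`;
Wells (1980), Thm. III.4.13). [cite: WellsDACM1980, Thm. III.4.13]
[cite: Voisin2002KaehlerCounterexample, §3 Prop. 3] -/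
theorem VoisinWeilTorusWitness.exists_complexDeRhamIsoFamily {E : Type u} [NormedAddCommGroup E]
    [NormedSpace ℂ E] [FiniteDimensional ℂ E] (W : VoisinWeilTorusWitness E) :
    Literature.NumberTheory.Transcendental.exists_complexDeRhamIsoFamily E := by
  letI := W.topologicalSpace; letI := W.chartedSpace; letI := W.isManifold_real
  letI := W.t2Space; letI := W.compactSpace
  obtain ⟨e, he, -⟩ := W.isOfType
  exact ⟨e, he⟩

/-- **The barrier fact implies de Rham's theorem for `ℂ⁴`-charted manifolds**
(`exists_complexDeRhamIsoFamily (Fin 4 → ℂ)`, Wells (1980), Thm. III.4.13): the natural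
comparison family packaged in the type-`(2,2)` clause of the witness. Recorded as the precise
upstream dependency of the discharge `Voisin2002_weilTorus_hodgeClassWithoutSubvarieties_holds`.
[cite: WellsDACM1980, Thm. III.4.13] [cite: Voisin2002KaehlerCounterexample, Thm. 1 and §3 Prop. 3] -/
theorem Voisin2002_weilTorus_hodgeClassWithoutSubvarieties.exists_complexDeRhamIsoFamily
    (h : Voisin2002_weilTorus_hodgeClassWithoutSubvarieties) :
    Literature.NumberTheory.Transcendental.exists_complexDeRhamIsoFamily (Fin 4 → ℂ) := by
  obtain ⟨W⟩ := h
  exact W.exists_complexDeRhamIsoFamily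

end HodgeConjecture
end Barriers

end Literature.Barriers.HodgeConjecture

end
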